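import Literature.MathematicalPhysics.QuantumFieldTheory.Balaban1983to89.B9Thm312WholeFromThm310R1A
import Literature.MathematicalPhysics.QuantumFieldTheory.Balaban1983to89.B9RWSums346SecondDiffLeftPairMG

/-!
# `Balaban1983to89.B9Thm312WholeFromThm310R1A3` — «THEOREM 3.3 FOR G₀» FROM THEOREM 3.10's SUM, OVER THE DIRECTION LETTERS, ₃ EDITION: the two
# second-order L² lines by the LEFT Neumann series (dag-n06-c's `B9Thm312WholeFromThm310R1A.thm33G0L2M_of_conv3107_l4₂ ∕ thm33G0L2M_of_conv3107₂`
# with `hF3 : FactorsL2Second310` REMOVED)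

T. Bałaban, *Propagators for lattice gauge theories in a background field*, Commun. Math. Phys. **99** (1985) 389–434
[`Balaban1985BackgroundPropagators`, "B9"], Thm 3.10 (3.105)–(3.108) pp. 414–416, Thm 3.3 p. 399, (3.42)–(3.46) pp. 397–398, (3.39)–(3.40) p. 397, p. 413,
p. 421 (G₀ := G), pp. 409–410 (the Neumann series and its transpose); T. Bałaban, *Propagators and renormalization transformations for lattice gauge
theories. II*, Commun. Math. Phys. **96** (1984) 223–250 [`Balaban1984PropagatorsII`, "[4]"], (2.52)–(2.55) p. 232, Lemma 2.1 (2.60)–(2.61) p. 234.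

statement-level skeleton of published theorems with citation tags; proofs where landed; nothing here is a claim about the
Yang–Mills mass gap

WHY THIS FILE (cell `pub-ymgap`, Track A node N06 [B9], rows 19–21; width seat `pub-ymgap-dag-n06-w1` g5; dag-n06-w1 LOCATED-SCHEMA-1 bus l.38190,
dag-n06-d g12 CALL l.38294, dag-n06-c g12 GO l.38793).  The v2 faces take, for the L² lines 3 ∕ 5 of `Thm33G0L2M` (`∇_ν∇_μG₀`, `G₀∇*_ν∇*_μ`, G₀ := G),
n06-k's right-form engine `B9RWSums346SecondDiffDir.l2line3∕5_of_local310_dir`, whose input `hF3 : FactorsL2Second310 𝔬′ 𝔡 R H θ3 δ₀ U` (a block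
bound `θ₃·len⁻²` on `K(h)·G_□M_h∇*∇*`) is off print's scale and has no faithful inhabitant.  Print's road (pp. 409–410, 416) is the LEFT series
`G∇*∇* = Σₙ(ΣₐRₐᵀ)ⁿ·(ΣₐRₐᵀ·G₀(a)∇*∇*)`, the transpose of `∇∇G = Σₐ∇∇G₀(a)Rₐ·ΣₙRⁿ`, which needs only the random-walk factors `Factors389` (already a
conjunct of the certificate's A-side bundle `h36A`), the kinematic letter transposes `Rₐᵗ = Rₐᵀ` and an «M large» threshold making the series
converge in the L² block norm (p. 416: *"for M sufficiently large"*).  THIS FILE: `thm33G0L2M_of_conv3107_l4₃`, `thm33G0L2M_of_conv3107₃` — the v2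
texts VERBATIM except: binder `θ3 ↦ θ₀` (same slot), `hθ3 ↦ hθ₀`, `hF3 ↦ (hfac : Factors389 𝔬′ R H θ₀ δ₀ U) (hRT : ∀ a, IsTransposePair (Rt U a) (Rf U a))`,
`+ (hδ₀ : 0 ≤ δ₀) (hα₁ : 0 ≤ α₁) (hδ5 : δ ≤ (1 − 2α₁)δ₀) (hMbig : 2·N_F·θ₀·√L₀·c₁(d₁, δ₀, α₁) ≤ g.M)` after `hrate`, `hB3′ : 2·(N₃·B₃)·L₀ ≤ B₂`
(the constant `secondConst …` gone), lines 3 ∕ 5 by dag-n06-w1's `B9RWSums346SecondDiffLeftPairMG.l2line3∕5_left_pairMG`.  `thm33G0Dir_of_conv3107₂`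
does not read `hF3` and needs no twin.

HONEST SCOPE.  Kernel bookkeeping over landed modules: NOTHING of print asserted; the new hypotheses are EXISTING species (`Factors389`, letter
transposes, numerics).  COUNT-NEUTRAL; N06 NOT discharged; K1⁹ NOT closed; one finite lattice at a time; nothing continuum, nothing about OS positivity
or the mass gap; the YM mass gap (Clay) is NOT proved by any of this — R4 closes the conditional finite-𝕋⁴ rung `BalabanLadder.UV` only.
-/

namespace Literature.MathematicalPhysics.QuantumFieldTheory.Balaban1983to89.B9Thm312WholeFromThm310R1A3

open Literature.MathematicalPhysics.QuantumFieldTheory.Balaban1983to89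
open Finset B6RandomWalk B6RandomWalkHom B9Thm34Ext B11SectG B9Thm37Glue B9SectDL2Decay B9Ineq347
open B9Thm312Whole B9Thm312WholeLeft B9Thm312WholeClasses B9Thm312WholeBlocksNbr B9Thm312WholeDir B9Thm313WholeDir
open B9Thm310Whole B9RWSums343Holder B9RWSums343to347Whole B9RWSums346Schur B9RWSums346Two B9RWSums346MixedPair
open B9RWSums344Input B9RWSums344InputPair B9RWSums346SecondDiff B9Thm312WholeFromThm310 B9Thm312WholeFromThm310L2
open B9Thm37WholeDir B9Thm310WholeDir B9RWSums343HolderDir B9RWSums344InputPairGDir B9RWSums346MixedPairGDir B9RWSums346SecondDiffDir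
open B9RWSums346TwoDir B9Thm312WholeFromThm310R1A B9RWSums346SecondDiffLeft B9RWSums346SecondDiffLeftPairMG

noncomputable section

variable {g : B9.Geometry} {B : B9.Backgrounds} {X Y Z W ι A PX PY P : Type} [Fintype g.Site] [Fintype P]
variable {R : ℝ} {H : Prop}

/-! ## §0 helper -/

/-- `0 ≤ twoConst …` (n06-l's private helper, copied). [folklore] -/
private theorem twoConst_nonneg₃ {d₁ : ℕ} {δ₁ α₁ N2 B2 NF θ2 C L₀ : ℝ} (hN2 : 0 ≤ N2) (hB2 : 0 ≤ B2) (hNF : 0 ≤ NF) (hθ2 : 0 ≤ θ2)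
    (hC : 0 ≤ C) (hL₀ : 0 ≤ L₀) : 0 ≤ twoConst d₁ δ₁ α₁ N2 B2 NF θ2 C L₀ := by
  have := c1_nonneg d₁ δ₁ α₁
  unfold twoConst
  positivity

/-! ## §1 The rows-20–21 L² schema over the direction letters, ₃ edition: `Thm33G0L2M` -/

section Assemble

variable [DecidableEq g.Site] [Fintype X] [DecidableEq X] [Fintype Y] [DecidableEq Y] [Fintype ι] [Fintype A]

omit [DecidableEq Y] in
/-- **(₃ EDITION — the two second-order L² lines 3 ∕ 5 by the LEFT Neumann series `G∇*∇* = Σₙ(ΣₐRₐᵀ)ⁿ·(ΣₐRₐᵀG₀(a)∇*∇*)`: `hF3 : FactorsL2Second310 … θ3 δ₀` (off print's scale, dag-n06-w1 LOCATED-SCHEMA-1) REPLACED by `hfac : Factors389 𝔬′ R H θ₀ δ₀ U` + the letter transposes `hRT : ∀ a, IsTransposePair (Rt U a) (Rf U a)` + the «M large» threshold `hMbig : 2N_Fθ₀√L₀·c₁(d₁, δ₀, α₁) ≦ M` + the numerics `0 ≦ δ₀`, `0 ≦ α₁`, `δ ≦ (1 − 2α₁)δ₀`; the constant `secondConst …`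 ↦ `2N₃B₃` in `hB3′`; lines 3 ∕ 5 by dag-n06-w1's `B9RWSums346SecondDiffLeftPairMG.l2line3∕5_left_pairMG`; everything else VERBATIM the v2 text that follows.)** ★★ **THEOREM 3.3 (3.46) FOR G₀ := G(U), THE ROWS-20–21 SCHEMA `Thm33G0L2M`, WITH THE BUNDLED TWO-SIDED LINE SUPPLIED, OVER THE DIRECTION
LETTERS (R1′-A)** — n06-l's `thm33G0L2M_of_conv3107_l4` VERBATIM with `hi : Identities310₂ 𝔬' 𝔡 𝔩 R H U` and the re-threaded engines
`l2line3∕5_of_local310_dir` ∕ `l2mixed_of_local310_dir`: from `Conv3107`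
(the sum's (3.42) sup majorants at (C, δ)), the symmetry of G(U) and the transposes (∇_UG)ᵀ = G∇\*_U, (∇_{U,μ})ᵀ = ∇\*_{U,μ}, p. 398's
transfer (`Facts347` at (δ, α)), and n06-k's per-pair L² lines of the sum (`l2line3∕5_of_local310`: legs `L2SecondLegs310` + factors
`FactorsL2Second310`; `l2mixed_of_local310`: `L2MixedLegs310` + `FactorsL2Mixed310` + `DirSup310`; the fixed point (3.106) via
`Identities310`; [4] Lemma 2.1 at the legs' rate δ₀); the bundled line ∇_UG₀∇\*_U is the hypothesis `hl4` (constant B₄, rate (1 − 2α)δ).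
Output: one constant B₂ ≧ C·L₀, secondConst·L₀, mixedConst, B₄ and one rate ρ ≦ (1 − 3α)δ.  Nothing of print asserted.
[cite: Balaban1985BackgroundPropagators, Thm 3.10 (3.105)–(3.108) pp.414–416 + Thm 3.3 p.399 + (3.46) p.398 + (3.42) p.397 + (3.39) p.397 + p.398 remark after (3.47) + p.413 + p.391; Balaban1984PropagatorsII, (2.52)–(2.55) p.232 + Lemma 2.1 p.234] -/
theorem thm33G0L2M_of_conv3107_l4₃ (𝔬 : B9Thm312Whole.Ops g B X Y Z W) (𝔬' : Ops310 g B X Y ι A) (𝔡 : DirOps310 𝔬' P)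
    (𝔩 : DirLetters310 𝔬' P)
    (d d₁ : ℕ) (δ α L₀ δ₀ α₁ ρ' N N' NF Cℓ N3 B3 θ₀ NM BM θM C B₄ B₂ ρ : ℝ) (κ : Sizes310)
    (S3 SM : ι → Finset g.Site) (U : B.Cfg)
    -- the letter identifications (G₀ := G)
    (hblk : 𝔬.blk = 𝔬'.blk) (hblkY : 𝔬.blkY = 𝔬'.blkY) (hG0 : 𝔬.G0 U = 𝔬'.G U) (hD : 𝔬.D U = 𝔬'.D U)
    (hDs : 𝔬.Dstar U = 𝔬'.Dstar U)
    -- numerics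
    (hNF : 0 ≤ NF) (hN3 : 0 ≤ N3) (hB3 : 0 ≤ B3) (hθ₀ : 0 ≤ θ₀) (hNM : 0 ≤ NM) (hBM : 0 ≤ BM) (hθM : 0 ≤ θM)
    (hM : 1 ≤ g.M) (hC : 0 ≤ C) (hαδ : 0 ≤ α * δ) (hα2 : 2 * α * δ ≤ δ) (hα₁δ₀ : 0 ≤ α₁ * δ₀)
    (hrate : (1 - 2 * α) * δ ≤ (1 - α₁) * δ₀) (hδ₀ : 0 ≤ δ₀) (hα₁ : 0 ≤ α₁) (hδ5 : δ ≤ (1 - 2 * α₁) * δ₀)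
    (hMbig : 2 * NF * θ₀ * Real.sqrt L₀ * B6.c1 d₁ δ₀ α₁ ≤ g.M) (hB₄ : 0 ≤ B₄)
    (hB1 : C * L₀ ≤ B₂) (hB3' : 2 * (N3 * B3) * L₀ ≤ B₂)
    (hBM' : mixedConst d₁ δ₀ α₁ NM BM NF θM C L₀ ≤ B₂) (hB4' : B₄ ≤ B₂) (hρ : ρ ≤ (1 - 3 * α) * δ)
    -- static data, member facts, Lemma 2.1
    (hs : StaticOK310 𝔬' ρ' N N' NF Cℓ κ)
    (hcnt3 : ∀ a : g.Site, (∑ i, if a ∈ S3 i then (1 : ℝ) else 0) ≤ N3)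
    (hcntM : ∀ a : g.Site, (∑ i, if a ∈ SM i then (1 : ℝ) else 0) ≤ NM)
    (h261 : Ineq261 d₁ (toB6 g R H) δ₀ α₁) (hF : Facts347 g R H d δ α L₀)
    -- rows 18–19's Theorem-3.10 schemas at U (n06-k), the symmetry ∕ transposition letters, the sum's (3.42) majorants
    (hi : Identities310₂ 𝔬' 𝔡 𝔩 R H U)
    (hL3 : L2SecondLegs310 𝔬' 𝔡 R H S3 B3 δ₀ U) (hfac : B9Thm310Whole.Factors389 𝔬' R H θ₀ δ₀ U)
    (hRT : ∀ a, IsTransposePair (𝔬'.Rt U a) (𝔬'.Rf U a))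
    (hLM : L2MixedLegs310 𝔬' 𝔡 R H SM BM δ₀ U) (hFM : FactorsL2Mixed310 𝔬' 𝔡 R H θM δ₀ U)
    (hDS : DirSup310 𝔬' 𝔡 R H U) (hDT : DirTranspose310 𝔬' 𝔡 U)
    (hsym : IsTransposePair (𝔬'.G U) (𝔬'.G U)) (htr : IsTransposePair (𝔬'.D U ∘ₗ 𝔬'.G U) (𝔬'.G U ∘ₗ 𝔬'.Dstar U))
    (hc : Conv3107 𝔬' R H C δ U)
    (hl4 : BlockBd (g := toB6 g R H) 𝔬'.blkY 𝔬'.blkY (𝔬'.D U ∘ₗ (𝔬'.G U ∘ₗ 𝔬'.Dstar U))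
      (fun (y y' : g.Site) => B₄ * Real.exp (-((1 - 2 * α) * δ * g.dist y y')))) :
    Thm33G0L2M 𝔬 𝔡.Dd 𝔡.Dsd R H B₂ ρ U := by
  have hlen0 : ∀ y : g.Site, 0 ≤ g.len y := fun y => (hs.lenpos y).le
  have hL₀ : 0 ≤ L₀ := le_trans (le_trans zero_le_one hF.one_le_L) hF.L_le
  have hL₀1 : 1 ≤ L₀ := le_trans hF.one_le_L hF.L_le
  have hCB : C ≤ B₂ := le_trans (by nlinarith [hL₀1, hC]) hB1
  have hB₂ : 0 ≤ B₂ := le_trans hC hCB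
  have hCL : 0 ≤ C * L₀ := mul_nonneg hC hL₀
  -- the rates: δ ≥ (1−α)δ ≥ (1−2α)δ ≥ (1−3α)δ ≥ ρ
  have hρ0 : ρ ≤ δ := by nlinarith [hρ, hαδ]
  have hρ1 : ρ ≤ (1 - α) * δ := by nlinarith [hρ, hαδ]
  have hρ2 : ρ ≤ (1 - 2 * α) * δ := by nlinarith [hρ, hαδ]
  have hρ3 : ρ ≤ (1 - 2 * α) * δ - α * δ := by nlinarith [hρ, hαδ]
  have hexp : ∀ {r : ℝ}, ρ ≤ r → ∀ y y' : g.Site, Real.exp (-(r * g.dist y y')) ≤ Real.exp (-(ρ * g.dist y y')) :=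
    fun hr y y' => Real.exp_le_exp.mpr (neg_le_neg (mul_le_mul_of_nonneg_right hr (hs.dnn y y')))
  -- the generic weakening (c ≤ B₂, w ≥ 0, r ≥ ρ)
  have hweak : ∀ {c r : ℝ} (w : ℝ), 0 ≤ w → 0 ≤ c → c ≤ B₂ → ρ ≤ r → ∀ y y' : g.Site,
      c * w * Real.exp (-(r * g.dist y y')) ≤ B₂ * w * Real.exp (-(ρ * g.dist y y')) :=
    fun w hw hc0 hcB hr y y' => mul_le_mul (mul_le_mul_of_nonneg_right hcB hw) (hexp hr y y') (Real.exp_nonneg _)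
      (mul_nonneg hB₂ hw)
  -- the per-direction transposes (∇_νG)ᵀ = G∇*_ν
  have htrd : ∀ ν : P, IsTransposePair (𝔡.Dd U ν ∘ₗ 𝔬'.G U) (𝔬'.G U ∘ₗ 𝔡.Dsd U ν) := fun ν => hsym.comp (hDT.tr ν).symm
  -- n06-k's lines of the sum
  have hS0 := const_le_ratio_transfer hF hs.lenpos
    (S := 2 * (N3 * B3)) (r := (1 - 2 * α) * δ) (mul_nonneg zero_le_two (mul_nonneg hN3 hB3))
  have hS0' := const_le_ratio_transfer' hF hs.lenpos hs.symm
    (S := 2 * (N3 * B3)) (r := (1 - 2 * α) * δ) (mul_nonneg zero_le_two (mul_nonneg hN3 hB3))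
  have hSK : 0 ≤ 2 * (N3 * B3) * L₀ := mul_nonneg (mul_nonneg zero_le_two (mul_nonneg hN3 hB3)) hL₀
  refine
    { l0 := ?_
      l1 := ?_
      l2 := ?_
      l3 := fun q => ?_
      l4 := ?_
      l5 := fun q => ?_
      l1d := fun ν => ?_
      l2d := fun μ => ?_
      l4m := fun q => ?_ }
  · -- line 0: Schur, no transfer (rate δ)
    rw [hblk, hG0]
    refine (blockBd_l0_of_sup (R := R) (H := H) hC hs.symm hlen0 𝔬'.blk hc.1 hsym).mono fun y y' => ?_
    have h := hweak (g.len y * g.len y') (mul_nonneg (hlen0 y) (hlen0 y')) hC hCB hρ0 y y'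
    calc C * g.len y * g.len y' * Real.exp (-(δ * g.dist y y'))
        = C * (g.len y * g.len y') * Real.exp (-(δ * g.dist y y')) := by ring
      _ ≤ B₂ * (g.len y * g.len y') * Real.exp (-(ρ * g.dist y y')) := h
      _ = B₂ * g.len y * g.len y' * Real.exp (-(ρ * g.dist y y')) := by ring
  · -- line 1: ∇_UG₀ at the input scale
    rw [hblk, hblkY, hG0, hD]
    exact (blockBd_l1_of_sup hF hC hs.symm hs.lenpos 𝔬'.blk 𝔬'.blkY hc.2.1 hc.2.2.1 htr).mono fun y y' =>
      hweak (g.len y') (hlen0 y') hCL hB1 hρ1 y y'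
  · -- line 2: G₀∇*_U at the output scale (n06-k's `blockBd_entry2` verbatim)
    rw [hblk, hblkY, hG0, hDs]
    exact (blockBd_entry2 hF hC hs.symm hs.lenpos 𝔬'.blk 𝔬'.blkY hc.2.1 hc.2.2.1 htr).mono fun y y' =>
      hweak (g.len y) (hlen0 y) hCL hB1 hρ1 y y'
  · -- line 3: ∇_ν∇_μG₀ per pair, n06-k's line + the transfer at the swapped pair
    rw [hblk, hG0]
    have h3 := l2line3_left_pairMG 𝔬' 𝔡 𝔩 R H d d₁ δ α L₀ δ₀ α₁ ρ' N N' NF Cℓ N3 B3 θ₀ κ S3 U hNF hN3 hB3 hθ₀ hδ₀ hα₁ hαδ hα2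
      hδ5 hs hM hMbig hcnt3 h261 hF hi hfac hRT hL3 hDT hsym q.1 q.2
    refine h3.mono fun y y' => (hS0' y y').trans ?_
    exact hweak ((g.len y)⁻¹ * g.len y') (mul_nonneg (inv_nonneg.mpr (hlen0 y)) (hlen0 y')) hSK hB3' hρ3 y y'
  · -- line 4 (bundled): supplied
    rw [hblkY, hG0, hD, hDs]
    refine hl4.mono fun y y' => ?_
    have h := hweak 1 zero_le_one hB₄ hB4' hρ2 y y'
    simpa only [mul_one] using h
  · -- line 5: G₀∇*_ν∇*_μ per pair, n06-k's line + the transfer at the direct pair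
    rw [hblk, hG0]
    have h5 := l2line5_left_pairMG 𝔬' 𝔡 𝔩 R H d d₁ δ α L₀ δ₀ α₁ ρ' N N' NF Cℓ N3 B3 θ₀ κ S3 U hNF hN3 hB3 hθ₀ hδ₀ hα₁ hαδ hα2
      hδ5 hs hM hMbig hcnt3 h261 hF hi hfac hRT hL3 q.1 q.2
    refine h5.mono fun y y' => (hS0 y y').trans ?_
    exact hweak (g.len y * (g.len y')⁻¹) (mul_nonneg (hlen0 y) (inv_nonneg.mpr (hlen0 y'))) hSK hB3' hρ3 y y'
  · -- ∇_{U,ν}G₀ at the input scale: Schur on the components (`DirSup310`) + adjoint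
    rw [hblk, hG0]
    exact (blockBd_l1_of_sup hF hC hs.symm hs.lenpos 𝔬'.blk 𝔬'.blk (hDS.left _ hc.2.1 ν) (hDS.right _ hc.2.2.1 ν)
      (htrd ν)).mono fun y y' => hweak (g.len y') (hlen0 y') hCL hB1 hρ1 y y'
  · -- G₀∇*_{U,μ} at the output scale
    rw [hblk, hG0]
    exact (blockBd_entry2 hF hC hs.symm hs.lenpos 𝔬'.blk 𝔬'.blk (hDS.left _ hc.2.1 μ) (hDS.right _ hc.2.2.1 μ)
      (htrd μ)).mono fun y y' => hweak (g.len y) (hlen0 y) hCL hB1 hρ1 y y'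
  · -- the mixed pair line (n06-k's `l2mixed_of_local310` verbatim)
    rw [hblk, hG0]
    have hm := l2mixed_of_local310_dir 𝔬' 𝔡 𝔩 R H d d₁ δ α L₀ δ₀ α₁ ρ' N N' NF Cℓ NM BM θM C κ SM U hNF hNM hBM hθM hM hC hα2
      hα₁δ₀ hrate hs hcntM h261 hF hi hLM hFM hDS hDT hc.2.1 hc.2.2.1 hsym q.1 q.2
    refine hm.mono fun y y' => ?_
    have h := hweak 1 zero_le_one (mixedConst_nonneg hNM hBM hNF hθM hC hL₀) hBM' hρ2 y y'
    simpa only [mul_one] using h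

/-- **(₃ EDITION — as `thm33G0L2M_of_conv3107_l4₃`: `hF3` ↦ `hfac` + `hRT` + `hMbig` + numerics, `hB3′` at `2N₃B₃·L₀`; everything else VERBATIM the v2 text that follows.)** ★★ **THE SAME WITH THE BUNDLED TWO-SIDED LINE FROM n06-k's ONE-SLOT LEGS, OVER THE DIRECTION LETTERS (R1′-A)** — n06-l's
`thm33G0L2M_of_conv3107` VERBATIM with `hi : Identities310₂ …` and `B9RWSums346TwoDir.l2line4_of_local310_dir` (`B9RWSums346Two.L2TwoLegs310 ∕ FactorsL2_310`, an EXISTING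
schema species of rows 18–19's lineage, via `l2line4_of_local310`; constant `twoConst`): `Thm33G0L2M 𝔬 Dd Dsd R H B₂ ρ U` with no L² line
of G₀ displayed at all. [cite: Balaban1985BackgroundPropagators, Thm 3.10 (3.105)–(3.108) pp.414–416 + Thm 3.3 p.399 + (3.46) p.398 + (3.42) p.397 + p.398 remark after (3.47) + p.413; Balaban1984PropagatorsII, (2.52)–(2.55) p.232 + Lemma 2.1 p.234] -/
theorem thm33G0L2M_of_conv3107₃ (𝔬 : B9Thm312Whole.Ops g B X Y Z W) (𝔬' : Ops310 g B X Y ι A) (𝔡 : DirOps310 𝔬' P)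
    (𝔩 : DirLetters310 𝔬' P)
    (d d₁ : ℕ) (δ α L₀ δ₀ α₁ ρ' N N' NF Cℓ N2 B2' θ2 N3 B3 θ₀ NM BM θM C B₂ ρ : ℝ) (κ : Sizes310)
    (S2 S3 SM : ι → Finset g.Site) (U : B.Cfg)
    (hblk : 𝔬.blk = 𝔬'.blk) (hblkY : 𝔬.blkY = 𝔬'.blkY) (hG0 : 𝔬.G0 U = 𝔬'.G U) (hD : 𝔬.D U = 𝔬'.D U)
    (hDs : 𝔬.Dstar U = 𝔬'.Dstar U)
    (hNF : 0 ≤ NF) (hN2 : 0 ≤ N2) (hB2' : 0 ≤ B2') (hθ2 : 0 ≤ θ2) (hN3 : 0 ≤ N3) (hB3 : 0 ≤ B3) (hθ₀ : 0 ≤ θ₀)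
    (hNM : 0 ≤ NM) (hBM : 0 ≤ BM) (hθM : 0 ≤ θM)
    (hM : 1 ≤ g.M) (hC : 0 ≤ C) (hαδ : 0 ≤ α * δ) (hα2 : 2 * α * δ ≤ δ) (hα₁δ₀ : 0 ≤ α₁ * δ₀)
    (hrate : (1 - 2 * α) * δ ≤ (1 - α₁) * δ₀) (hδ₀ : 0 ≤ δ₀) (hα₁ : 0 ≤ α₁) (hδ5 : δ ≤ (1 - 2 * α₁) * δ₀)
    (hMbig : 2 * NF * θ₀ * Real.sqrt L₀ * B6.c1 d₁ δ₀ α₁ ≤ g.M)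
    (hB1 : C * L₀ ≤ B₂) (hB3' : 2 * (N3 * B3) * L₀ ≤ B₂)
    (hBM' : mixedConst d₁ δ₀ α₁ NM BM NF θM C L₀ ≤ B₂) (hB4' : twoConst d₁ δ₀ α₁ N2 B2' NF θ2 C L₀ ≤ B₂)
    (hρ : ρ ≤ (1 - 3 * α) * δ)
    (hs : StaticOK310 𝔬' ρ' N N' NF Cℓ κ)
    (hcnt2 : ∀ a : g.Site, (∑ i, if a ∈ S2 i then (1 : ℝ) else 0) ≤ N2)
    (hcnt3 : ∀ a : g.Site, (∑ i, if a ∈ S3 i then (1 : ℝ) else 0) ≤ N3)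
    (hcntM : ∀ a : g.Site, (∑ i, if a ∈ SM i then (1 : ℝ) else 0) ≤ NM)
    (h261 : Ineq261 d₁ (toB6 g R H) δ₀ α₁) (hF : Facts347 g R H d δ α L₀)
    (hi : Identities310₂ 𝔬' 𝔡 𝔩 R H U)
    (hL2 : L2TwoLegs310 𝔬' R H S2 B2' δ₀ U) (hF2 : FactorsL2_310 𝔬' R H θ2 δ₀ U)
    (hL3 : L2SecondLegs310 𝔬' 𝔡 R H S3 B3 δ₀ U) (hfac : B9Thm310Whole.Factors389 𝔬' R H θ₀ δ₀ U)
    (hRT : ∀ a, IsTransposePair (𝔬'.Rt U a) (𝔬'.Rf U a))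
    (hLM : L2MixedLegs310 𝔬' 𝔡 R H SM BM δ₀ U) (hFM : FactorsL2Mixed310 𝔬' 𝔡 R H θM δ₀ U)
    (hDS : DirSup310 𝔬' 𝔡 R H U) (hDT : DirTranspose310 𝔬' 𝔡 U)
    (hsym : IsTransposePair (𝔬'.G U) (𝔬'.G U)) (htr : IsTransposePair (𝔬'.D U ∘ₗ 𝔬'.G U) (𝔬'.G U ∘ₗ 𝔬'.Dstar U))
    (hc : Conv3107 𝔬' R H C δ U) :
    Thm33G0L2M 𝔬 𝔡.Dd 𝔡.Dsd R H B₂ ρ U := by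
  have hL₀ : 0 ≤ L₀ := le_trans (le_trans zero_le_one hF.one_le_L) hF.L_le
  have h4 := l2line4_of_local310_dir 𝔬' 𝔡 𝔩 R H d d₁ δ α L₀ δ₀ α₁ ρ' N N' NF Cℓ N2 B2' θ2 C κ S2 U hNF hN2 hB2' hθ2 hM hC hα2 hα₁δ₀
    hrate hs hcnt2 h261 hF hi hL2 hF2 hc.2.1 hc.2.2.1 htr
  exact thm33G0L2M_of_conv3107_l4₃ 𝔬 𝔬' 𝔡 𝔩 d d₁ δ α L₀ δ₀ α₁ ρ' N N' NF Cℓ N3 B3 θ₀ NM BM θM C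
    (twoConst d₁ δ₀ α₁ N2 B2' NF θ2 C L₀) B₂ ρ κ S3 SM U hblk hblkY hG0 hD hDs hNF hN3 hB3 hθ₀ hNM hBM hθM hM hC hαδ hα2
    hα₁δ₀ hrate hδ₀ hα₁ hδ5 hMbig (twoConst_nonneg₃ hN2 hB2' hNF hθ2 hC hL₀) hB1 hB3' hBM' hB4' hρ hs hcnt3 hcntM h261 hF hi hL3
    hfac hRT hLM hFM hDS hDT hsym htr hc h4

end Assemble

end

end Literature.MathematicalPhysics.QuantumFieldTheory.Balaban1983to89.B9Thm312WholeFromThm310R1A3
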